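import Summits.Ventures.LatticeQCDFlow.Scoring.MadrasSokalRatioCLT

/-!
# The CLT for the KNOWN-NORMALISATION windowed estimator `τ̂_W^lin = ½ + Σ_{t=1}^{W} Γ̂_N(t)/σ²`: `√N (τ̂_W^lin − τ_W) ⇒ N(0, vᵀ Σ v)`, and `vᵀ Σ v = V(W)` in the Gaussian (Wick) model

HONEST FRAMING: exact (Metropolis-corrected) sampling algorithms for lattice gauge theory;
figures of merit are autocorrelation/cost numbers at stated couplings and volumes; no
continuum-physics claim.

Venture `LatticeQCDFlow` (cell pub-lqcd), sub-topic `Scoring`; FANOUT row 16 (`su2-base`), GEN-7.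
NEW WORK of the cell over `Scoring/MadrasSokalRatioCLT` and GEN-6's `Scoring/MadrasSokalErrorFormula`
(`tauHatLin`, `tauHatAVar = V(W)`, `tendsto_variance_tauHatLin`); nothing is cited as a fact.

Ninth file of the LAW-OF-THE-ERROR packet: the companion statistic.  GEN-6 analysed two windowed
estimators — the known-normalisation `τ̂_W^lin = ½ + Σ Γ̂(t)/σ²` (variance limit `V(W)`,
`MadrasSokalErrorFormula`) and the ratio `½ + Σ Γ̂(t)/Γ̂(0)` (variance limit `R(W)`,
`MadrasSokalRatioVariance`).  `MadrasSokalRatioCLT` gave the ratio its CLT; this file gives the linear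
one its CLT (continuous mapping of the joint CLT — no delta method needed) and identifies the limit
variance with `V(W)` by uniqueness of limits.

## Contents

* `knownNormVec W σ²` (`v_0 = 0`, `v_t = 1/σ²`), `inner_knownNormVec`, **`tauHatLin_eq_inner`**
  (`τ̂_W^lin = ½ + ⟪v, Γ̂_N⟫`).
* **`tendstoInDistribution_tauHatLin`** — block-factor process, square-integrable lag products:
  `√N (τ̂_W^lin(N) − (½ + Σ_{t=1}^{W} c(t)/σ²)) ⇒ ⟪v, Z⟫ ~ N(0, vᵀ Σ v)`.
* **`tendsto_variance_tauHatLin_blockFactor`** (`N·Var[τ̂_W^lin] → vᵀ Σ v`, any block-factor process),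
  **`knownNormQuadForm_eq_tauHatAVar`** (Wick model: `vᵀ Σ v = tauHatAVar ρ W = V(W)`),
  **`tendstoInDistribution_tauHatLin_wick`** — `√N (τ̂_W^lin(N) − tauIntWindow ρ W) ⇒ ⟪v, Z⟫ ~ N(0, V(W))`;
  with GEN-6's `tauHatAVar_lt_msDTau_sq` (`ρ ≥ 0`: `V(W) < N δτ_B²` at EVERY `W`) the printed bar
  over-covers this estimator's Gaussian limit at every window, not only asymptotically in `W`.

NOT CLAIMED: as in `MadrasSokalRatioCLT` (fixed `W`, known mean, no studentisation, no rates).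
-/

noncomputable section

open MeasureTheory ProbabilityTheory Filter Finset WithLp
open scoped Topology NNReal RealInnerProductSpace

namespace Summit.Ventures.LatticeQCDFlow.Scoring

section KnownNorm

variable {Ω : Type*} [MeasurableSpace Ω] {P : Measure Ω} [IsProbabilityMeasure P]
variable {Ω' : Type*} [MeasurableSpace Ω'] {P' : Measure Ω'} [IsProbabilityMeasure P']
variable {S : Type*} [MeasurableSpace S] {ξ : ℕ → Ω → S} {m : ℕ} {F : (Fin (m + 1) → S) → ℝ}

/-- The coefficient vector of the known-normalisation estimator: `v_0 = 0`, `v_t = 1/σ²` (`t ≥ 1`). [ours] -/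
def knownNormVec (W : ℕ) (σ2 : ℝ) : EuclideanSpace ℝ (Fin (W + 1)) :=
  toLp 2 fun i : Fin (W + 1) => if i = 0 then 0 else 1 / σ2

/-- `⟪v, (c(t))_t⟫ = Σ_{t=1}^{W} c(t)/σ²`. -/
theorem inner_knownNormVec (W : ℕ) (σ2 : ℝ) (c : ℕ → ℝ) :
    ⟪knownNormVec W σ2, toLp 2 fun t : Fin (W + 1) => c t⟫ = (∑ t ∈ range W, c (t + 1)) / σ2 := by
  rw [PiLp.inner_apply, Fin.sum_univ_succ]
  simp only [knownNormVec, PiLp.toLp_apply, RCLike.inner_apply, conj_trivial, Fin.succ_ne_zero,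
    if_true, if_false, mul_zero, zero_add, Fin.val_succ]
  rw [← Fin.sum_univ_eq_sum_range (fun t => c (t + 1)) W, sum_div]
  refine sum_congr rfl fun t _ => ?_
  ring

omit [MeasurableSpace Ω] [IsProbabilityMeasure P] in
/-- **GEN-6's `tauHatLin` is `½ + ⟪v, Γ̂_N⟫`.** -/
theorem tauHatLin_eq_inner (X : ℕ → Ω → ℝ) (σ2 : ℝ) (N W : ℕ) (ω : Ω) :
    tauHatLin X σ2 N W ω
      = 1 / 2 + ⟪knownNormVec W σ2, toLp 2 fun t : Fin (W + 1) => acovHat X N t ω⟫ := by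
  rw [inner_knownNormVec W σ2 (fun t => acovHat X N t ω), tauHatLin]

/-- **THE CLT FOR THE KNOWN-NORMALISATION ESTIMATOR** (a LINEAR functional of the autocovariance vector,
so continuous mapping suffices — no delta method): with `c(t) = E[X_0X_t]` and `Z` the Gaussian limit of
`LagProductCLT.tendstoInDistribution_acovHat`,
`√N (τ̂_W^lin(N) − (½ + Σ_{t=1}^{W} c(t)/σ²)) ⇒ ⟪v, Z⟫ ~ N(0, vᵀ Σ v)`. -/
theorem tendstoInDistribution_tauHatLin (hξ : ∀ i, Measurable (ξ i)) (hind : iIndepFun ξ P)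
    (hid : ∀ i, IdentDistrib (ξ i) (ξ 0) P P) (hF : Measurable F)
    (h4 : ∀ t, MemLp (fun ω => blockFactor F ξ 0 ω * blockFactor F ξ t ω) 2 P) (W : ℕ) (σ2 : ℝ)
    {Z : Ω' → EuclideanSpace ℝ (Fin (W + 1))} (hZm : AEMeasurable Z P')
    (hZ : ∀ a : EuclideanSpace ℝ (Fin (W + 1)), HasLaw (fun ω' => ⟪a, Z ω'⟫) (gaussianReal 0
      (∑ s : Fin (W + 1), ∑ t : Fin (W + 1),
        a s * a t * lagProdACov (blockFactor F ξ) P (m + W) s t).toNNReal) P') :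
    TendstoInDistribution
      (fun (N : ℕ) ω => Real.sqrt N * (tauHatLin (blockFactor F ξ) σ2 N W ω
          - (1 / 2 + (∑ t ∈ range W, P[fun ω => blockFactor F ξ 0 ω * blockFactor F ξ (t + 1) ω]) / σ2)))
      atTop (fun ω' => ⟪knownNormVec W σ2, Z ω'⟫) (fun _ => P) P' := by
  have hclt := tendstoInDistribution_acovHat hξ hind hid hF h4 W hZm hZ
  have h := hclt.continuous_comp (continuous_const.inner continuous_id : Continuous
    fun z : EuclideanSpace ℝ (Fin (W + 1)) => ⟪knownNormVec W σ2, z⟫)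
  refine h.congr (fun N => Eventually.of_forall fun ω => ?_) EventuallyEq.rfl
  simp only [Function.comp_apply]
  rw [real_inner_smul_right, inner_sub_right, tauHatLin_eq_inner,
    inner_knownNormVec W σ2 (fun t => P[fun ω => blockFactor F ξ 0 ω * blockFactor F ξ t ω])]
  ring

/-- **`N · Var[τ̂_W^lin] → vᵀ Σ v` for a block-factor process.** -/
theorem tendsto_variance_tauHatLin_blockFactor (hξ : ∀ i, Measurable (ξ i)) (hind : iIndepFun ξ P)
    (hid : ∀ i, IdentDistrib (ξ i) (ξ 0) P P) (hF : Measurable F)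
    (h4 : ∀ t, MemLp (fun ω => blockFactor F ξ 0 ω * blockFactor F ξ t ω) 2 P) (W : ℕ) (σ2 : ℝ) :
    Tendsto (fun N : ℕ => (N : ℝ) * Var[tauHatLin (blockFactor F ξ) σ2 N W; P]) atTop
      (𝓝 (∑ s : Fin (W + 1), ∑ t : Fin (W + 1),
        knownNormVec W σ2 s * knownNormVec W σ2 t * lagProdACov (blockFactor F ξ) P (m + W) s t)) := by
  set v := knownNormVec W σ2 with hv
  have hacov : ∀ N t : ℕ, MemLp (acovHat (blockFactor F ξ) N t) 2 P := by
    intro N t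
    have heq : acovHat (blockFactor F ξ) N t = fun ω =>
        (∑ j ∈ range N, blockFactor F ξ j ω * blockFactor F ξ (j + t) ω) * (1 / (N : ℝ)) := by
      funext ω; rw [acovHat_apply, div_eq_mul_one_div]
    rw [heq]
    exact (memLp_finsetSum _ fun j _ => memLp_lagProd hind hid hF h4 j t).mul_const _
  have hm : ∀ N (i : Fin (W + 1)), MemLp (fun ω => v i * acovHat (blockFactor F ξ) N i ω) 2 P :=
    fun N i => (hacov N i).const_mul (v i)
  have hvar : ∀ N : ℕ, Var[tauHatLin (blockFactor F ξ) σ2 N W; P]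
      = ∑ s : Fin (W + 1), ∑ t : Fin (W + 1),
          v s * v t * cov[acovHat (blockFactor F ξ) N s, acovHat (blockFactor F ξ) N t; P] := by
    intro N
    have e : tauHatLin (blockFactor F ξ) σ2 N W
        = fun ω => 1 / 2 + ∑ i : Fin (W + 1), v i * acovHat (blockFactor F ξ) N i ω := by
      funext ω
      rw [tauHatLin_eq_inner, PiLp.inner_apply]
      congr 1
      refine sum_congr rfl fun i _ => ?_
      simp only [RCLike.inner_apply, conj_trivial]
      ring
    rw [e, variance_const_add, variance_fun_sum fun i => hm N i]
    · refine sum_congr rfl fun s _ => sum_congr rfl fun t _ => ?_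
      rw [covariance_const_mul_left, covariance_const_mul_right, mul_assoc]
    · exact (memLp_finsetSum univ fun i _ => hm N i).aestronglyMeasurable
  simp_rw [hvar, mul_sum]
  refine tendsto_finsetSum _ fun s _ => tendsto_finsetSum _ fun t _ => ?_
  have h := (tendsto_covariance_acovHat_blockFactor hξ hind hid hF h4 (W := W) s t).const_mul (v s * v t)
  refine h.congr fun N => ?_
  ring

/-- **THE LIMIT VARIANCE IS `V(W)`** in the Gaussian (Wick) model: `vᵀ Σ v = tauHatAVar ρ W`, GEN-6's
limit of `N · Var[τ̂_W^lin]` (`MadrasSokalErrorFormula.tendsto_variance_tauHatLin`), by uniqueness of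
limits. -/
theorem knownNormQuadForm_eq_tauHatAVar (hξ : ∀ i, Measurable (ξ i)) (hind : iIndepFun ξ P)
    (hid : ∀ i, IdentDistrib (ξ i) (ξ 0) P P) (hF : Measurable F)
    {C : ℕ → ℕ → ℝ} (hW : IsWickFamily (blockFactor F ξ) C P) {σ2 : ℝ} {ρ : ℕ → ℝ}
    (hC : ∀ i j, C i j = σ2 * evenExt ρ ((j : ℤ) - i)) (hσ : σ2 ≠ 0) (hρ : Summable ρ) (W : ℕ) :
    ∑ s : Fin (W + 1), ∑ t : Fin (W + 1),
        knownNormVec W σ2 s * knownNormVec W σ2 t * lagProdACov (blockFactor F ξ) P (m + W) s t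
      = tauHatAVar ρ W :=
  tendsto_nhds_unique
    (tendsto_variance_tauHatLin_blockFactor hξ hind hid hF (fun t => hW.memLp 0 t) W σ2)
    (hW.tendsto_variance_tauHatLin hC hσ hρ W)

/-- **THE LAW OF THE ERROR OF THE KNOWN-NORMALISATION ESTIMATOR (Gaussian / Wick model):**
`√N (τ̂_W^lin(N) − tauIntWindow ρ W) ⇒ ⟪v, Z⟫ ~ N(0, V(W))`, `V(W) = tauHatAVar ρ W` — whose
`N · δτ_B² = (4W+2)τ²` comparison is GEN-6's `tauHatAVar_lt_msDTau_sq` (`ρ ≥ 0`: over-cover at EVERY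
window). -/
theorem tendstoInDistribution_tauHatLin_wick (hξ : ∀ i, Measurable (ξ i)) (hind : iIndepFun ξ P)
    (hid : ∀ i, IdentDistrib (ξ i) (ξ 0) P P) (hF : Measurable F)
    {C : ℕ → ℕ → ℝ} (hW : IsWickFamily (blockFactor F ξ) C P) {σ2 : ℝ} {ρ : ℕ → ℝ}
    (hC : ∀ i j, C i j = σ2 * evenExt ρ ((j : ℤ) - i)) (hσ : σ2 ≠ 0) (hρ : Summable ρ) (W : ℕ)
    {Z : Ω' → EuclideanSpace ℝ (Fin (W + 1))} (hZm : AEMeasurable Z P')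
    (hZ : ∀ a : EuclideanSpace ℝ (Fin (W + 1)), HasLaw (fun ω' => ⟪a, Z ω'⟫) (gaussianReal 0
      (∑ s : Fin (W + 1), ∑ t : Fin (W + 1),
        a s * a t * lagProdACov (blockFactor F ξ) P (m + W) s t).toNNReal) P') :
    TendstoInDistribution
      (fun (N : ℕ) ω => Real.sqrt N * (tauHatLin (blockFactor F ξ) σ2 N W ω - tauIntWindow ρ W))
      atTop (fun ω' => ⟪knownNormVec W σ2, Z ω'⟫) (fun _ => P) P'
    ∧ HasLaw (fun ω' => ⟪knownNormVec W σ2, Z ω'⟫) (gaussianReal 0 (tauHatAVar ρ W).toNNReal) P' := by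
  have hc : ∀ t : ℕ, P[fun ω => blockFactor F ξ 0 ω * blockFactor F ξ t ω] = σ2 * ρ t :=
    integral_lagProd_eq_of_wick hW hC
  have hτ : 1 / 2 + (∑ t ∈ range W, P[fun ω => blockFactor F ξ 0 ω * blockFactor F ξ (t + 1) ω]) / σ2
      = tauIntWindow ρ W := by
    simp only [tauIntWindow, hc, ← mul_sum]
    field_simp
  refine ⟨?_, ?_⟩
  · have h := tendstoInDistribution_tauHatLin hξ hind hid hF (fun t => hW.memLp 0 t) W σ2 hZm hZ
    rw [hτ] at h
    exact h
  · have h := hZ (knownNormVec W σ2)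
    rwa [knownNormQuadForm_eq_tauHatAVar hξ hind hid hF hW hC hσ hρ W] at h

end KnownNorm

end Summit.Ventures.LatticeQCDFlow.Scoring

end
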